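import Summits.KontsevichZagierPeriods.KontsevichZagierPeriods.Theorems.RootDecompWalshStrataConeBaker

/-!
# The pointless octant, part 1/4: dilation and the first Newton–Leibniz move

The ball octant `(0,1)³ ∩ {16(x²+y²+z²) < 7}` (radius `√7/4`; the sphere `16(x²+y²+z²) = 7` has NO
rational point: `7 = 8·0 + 7` is not a sum of three rational squares (Legendre, Davenport–Cassels);
volume `7√7·π/384`, an IRRATIONAL algebraic multiple of `π`) is the instance
`(d, P, q) = (3, 7/16 − x² − y² − z², 1)` of `QuadricBakerDescent` (route RootDecompWalshStrata,
support item r9) OUTSIDE the rational-point regime. This part: `octPoly`, `ballPoly`, `octSrc`, the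
DILATION chart `x = (√7/4)·u` (rule (2) with a `ℚ`-semialgebraic chart of algebraic-irrational
Jacobian `(√7/4)³`): `of_octSrc_sub_of_oct_mem_relations`, and Newton–Leibniz along `z` under the
unit hemisphere: `of_octSrc_sub_of_octDisc_mem_relations`. Imports: the cone specimen (parts 1–3,
for `discBase`, `unitIoo`); 0 sorry. [KontsevichZagier2001 §1.2 rules (1)–(3)]
-/

noncomputable section

open Literature.NumberTheory.Transcendental
open MeasureTheory Set
open MvPolynomial (aeval X C)
open Literature.ModelTheory.ExponentialFields (IsSemialgebraic isSemialgebraic_setOf_eval_pos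
  isSemialgebraic_setOf_eval_lt continuous_aeval_real)
open Summit.KontsevichZagierPeriods.RootDecompWalshStrata.WalshSpanProof (isSemialgebraic_cubeSet
  isBounded_cubeSet cellRep cellRep_domain cellRep_integrand)
open Summit.KontsevichZagierPeriods.RootDecompWalshStrata.ConeSpecimen

namespace Summit.KontsevichZagierPeriods.RootDecompWalshStrata.PointlessOctant


/-! ### The POINTLESS ball octant `16(x² + y² + z²) < 7` lands in the Baker sector

(gen 3 addendum; the critic's g4 option 2.) The sphere `16(x²+y²+z²) = 7` has no rational point
(`7` is not a sum of three rational squares), so — unlike the cone — no rational parametrisation is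
available and the value `vol = 7√7·π/384` carries an IRRATIONAL algebraic coefficient. The chain below
decides the cell inside the three rules nevertheless: a DILATION `x = (√7/4)·u` (rule (2) with an
algebraic-irrational but `ℚ`-semialgebraic linear chart, Jacobian `7√7/64`), Newton–Leibniz along
`z`, the RATIONAL-POLAR chart `(t,s) ↦ (s(1−t²)/(1+t²), 2st/(1+t²))` of the quarter disc
(Jacobian `2s/(1+t²)`), Newton–Leibniz along `s` (primitive `−(2c/3)(1−s²)√(1−s²)/(1+t²)`), and
the ABSORPTION chart `t = u/√7`, landing on the RATIONAL representation `[(0,√7), 49/(96(7+u²))]`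
(value `49π/(384√7) = 7√7π/384`). -/

/-- `7/16 − x² − y² − z²`: the Walsh cell `(0,1)³ ∩ {16(x²+y²+z²) < 7}` is the ball octant of
radius `√7/4`, whose boundary sphere has no rational point. -/
def octPoly : MvPolynomial (Fin 3) ℚ := C (7 / 16) - X 0 ^ 2 - X 1 ^ 2 - X 2 ^ 2

/-- `1 − x² − y² − z²` (the unit ball octant inside `(0,1)³`). -/
def ballPoly : MvPolynomial (Fin 3) ℚ := 1 - X 0 ^ 2 - X 1 ^ 2 - X 2 ^ 2

/-- Evaluation of `octPoly`. [folklore] -/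
@[simp] theorem aeval_octPoly (x : Fin 3 → ℝ) :
    aeval x octPoly = 7 / 16 - x 0 ^ 2 - x 1 ^ 2 - x 2 ^ 2 := by
  simp only [octPoly, map_sub, map_pow, MvPolynomial.aeval_C, MvPolynomial.aeval_X, eq_ratCast]
  push_cast
  ring

/-- Evaluation of `ballPoly`. [folklore] -/
@[simp] theorem aeval_ballPoly (x : Fin 3 → ℝ) :
    aeval x ballPoly = 1 - x 0 ^ 2 - x 1 ^ 2 - x 2 ^ 2 := by
  simp [ballPoly]

/-- `√7 · √7 = 7`. -/
theorem sqrt7_mul_self : √7 * √7 = (7:ℝ) := Real.mul_self_sqrt (by norm_num)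

/-- `√7 > 0`. -/
theorem sqrt7_pos : (0:ℝ) < √7 := Real.sqrt_pos.2 (by norm_num)

/-- `√7 < 4`. -/
theorem sqrt7_lt_four : √7 < (4:ℝ) := (Real.sqrt_lt' (by norm_num)).2 (by norm_num)

/-- `√(7/16) = √7/4`. -/
theorem sqrt_seven_sixteenths : √(7 / 16 : ℝ) = √7 / 4 := by
  rw [Real.sqrt_div' 7 (by norm_num : (0:ℝ) ≤ 16)]
  rw [show (16:ℝ) = 4 ^ 2 by norm_num, Real.sqrt_sq (by norm_num)]

/-- The algebraic constant `c = 7√7/64` (the Jacobian of the dilation) is a `ℚ`-semialgebraic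
(constant) function on any `ℚ`-semialgebraic set. [BCR1998 §2.2] -/
theorem isSemialgebraicFunOn_octConst {N : ℕ} {s : Set (Fin N → ℝ)} (hs : IsSemialgebraic ℚ s) :
    IsSemialgebraicFunOn ℚ s (fun _ => (7 / 64 : ℝ) * √7) :=
  (IsSemialgebraicFunOn.mul_holds (isSemialgebraicFunOn_ratCast hs (7 / 64))
    (IsSemialgebraicFunOn.sqrt_holds (isSemialgebraicFunOn_ratCast hs 7))).congr fun _ _ => by
      rw [Pi.mul_apply]; push_cast; ring

/-- `[(0,1)³ ∩ {x²+y²+z² < 1}, 7√7/64]`: the unit ball octant with the (algebraic, irrational)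
constant weight `7√7/64`. [KontsevichZagier2001 §1.1] -/
def octSrc : KZ.IntegralRep 3 where
  domain := {u | (∀ j, 0 < u j ∧ u j < 1) ∧ 0 < aeval u ballPoly}
  integrand _ := (7 / 64 : ℝ) * √7
  isSemialgebraic_domain := (cellRep ballPoly 1).isSemialgebraic_domain
  isSemialgebraicFunOn_integrand :=
    isSemialgebraicFunOn_octConst (cellRep ballPoly 1).isSemialgebraic_domain
  integrableOn := integrableOn_const
    (hs := (((isBounded_cubeSet 3).subset fun x hx => hx.1).measure_lt_top).ne)

/-- The domain of `octSrc` (the unit ball octant inside `(0,1)³`). [folklore] -/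
@[simp] theorem octSrc_domain :
    octSrc.domain = {u | (∀ j, 0 < u j ∧ u j < 1) ∧ 0 < aeval u ballPoly} := rfl

/-- The integrand of `octSrc` (the constant `7√7/64`). [folklore] -/
@[simp] theorem octSrc_integrand (u : Fin 3 → ℝ) : octSrc.integrand u = (7 / 64 : ℝ) * √7 := rfl

/-- The dilation `u ↦ (√7/4)·u` of `ℝ³`. -/
def dil (u : Fin 3 → ℝ) : Fin 3 → ℝ := (√7 / 4) • u

/-- Coordinates of the dilation. [folklore] -/
@[simp] theorem dil_apply (u : Fin 3 → ℝ) (j : Fin 3) : dil u j = √7 / 4 * u j := by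
  simp [dil, smul_eq_mul]

/-- Its (constant) derivative `(√7/4)·id`. -/
def dil' : (Fin 3 → ℝ) →L[ℝ] (Fin 3 → ℝ) := (√7 / 4) • ContinuousLinearMap.id ℝ (Fin 3 → ℝ)

/-- The dilation is differentiable with derivative `dil'`. [calculus] -/
theorem hasFDerivAt_dil (u : Fin 3 → ℝ) : HasFDerivAt dil dil' u :=
  ((ContinuousLinearMap.id ℝ (Fin 3 → ℝ)).hasFDerivAt.const_smul (√7 / 4)).congr_fderiv rfl

/-- `det dil' = (√7/4)³`. -/
theorem dil'_det : dil'.det = (√7 / 4) ^ 3 := by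
  rw [dil', ContinuousLinearMap.det, ContinuousLinearMap.toLinearMap_smul, ContinuousLinearMap.coe_id,
    LinearMap.det_smul, LinearMap.det_id, Module.finrank_fin_fun]
  simp

/-- The dilation is a `ℚ`-semialgebraic map (coordinatewise `u ↦ √(7/16)·u`). [BCR1998 §2.2] -/
theorem isSemialgebraicMapOn_dil {s : Set (Fin 3 → ℝ)} (hs : IsSemialgebraic ℚ s) :
    IsSemialgebraicMapOn ℚ s dil := by
  refine IsSemialgebraicMapOn.of_forall hs fun j => ?_
  exact (IsSemialgebraicFunOn.mul_holds
    (IsSemialgebraicFunOn.sqrt_holds (isSemialgebraicFunOn_ratCast hs (7 / 16)))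
    (isSemialgebraicFunOn_aeval hs (X j))).congr fun u _ => by
      simp only [Pi.mul_apply, MvPolynomial.aeval_X, dil_apply]
      all_goals norm_num [sqrt_seven_sixteenths]

/-- The dilation is injective. [folklore] -/
theorem injective_dil : Function.Injective dil := by
  intro x y h
  have hc : (√7 / 4 : ℝ) ≠ 0 := by positivity
  exact smul_right_injective (Fin 3 → ℝ) hc h

/-- The dilation maps the unit ball octant onto the octant of radius `√7/4`. -/
theorem image_dil : dil '' {u : Fin 3 → ℝ | (∀ j, 0 < u j ∧ u j < 1) ∧ 0 < aeval u ballPoly} =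
    {x | (∀ j, 0 < x j ∧ x j < 1) ∧ 0 < aeval x octPoly} := by
  have h7 := sqrt7_mul_self
  have h7p := sqrt7_pos
  have h74 := sqrt7_lt_four
  ext x
  simp only [mem_image, mem_setOf_eq, aeval_ballPoly, aeval_octPoly]
  constructor
  · rintro ⟨u, ⟨hu, hg⟩, rfl⟩
    simp only [dil_apply]
    refine ⟨fun j => ⟨mul_pos (by positivity) (hu j).1, ?_⟩, ?_⟩
    · have := (hu j).2
      nlinarith [(hu j).1]
    · have hsq : ∀ t : ℝ, (√7 / 4 * t) ^ 2 = 7 / 16 * t ^ 2 := fun t => by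
        rw [mul_pow, div_pow, Real.sq_sqrt (by norm_num : (0:ℝ) ≤ 7)]; norm_num
      rw [hsq, hsq, hsq]
      linarith
  · rintro ⟨hx, hg⟩
    refine ⟨fun j => 4 / √7 * x j, ⟨fun j => ⟨mul_pos (by positivity) (hx j).1, ?_⟩, ?_⟩, ?_⟩
    · -- `4 x_j / √7 < 1` since `x_j² < 7/16`
      have hxj : 0 < x j := (hx j).1
      have hle : x j ^ 2 ≤ x 0 ^ 2 + x 1 ^ 2 + x 2 ^ 2 := by
        have := Finset.single_le_sum (f := fun i => x i ^ 2) (fun i _ => sq_nonneg (x i))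
          (Finset.mem_univ j)
        simpa [Fin.sum_univ_three] using this
      have hsq : x j ^ 2 < 7 / 16 := by linarith
      show 4 / √7 * x j < 1
      rw [div_mul_eq_mul_div, div_lt_one h7p]
      nlinarith [Real.sq_sqrt (show (0:ℝ) ≤ 7 by norm_num), Real.sqrt_nonneg 7,
        mul_pos hxj h7p]
    · have hsq : ∀ t : ℝ, (4 / √7 * t) ^ 2 = 16 / 7 * t ^ 2 := fun t => by
        rw [mul_pow, div_pow, Real.sq_sqrt (by norm_num : (0:ℝ) ≤ 7)]; norm_num
      rw [hsq, hsq, hsq]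
      linarith
    · funext j
      simp only [dil_apply]
      field_simp

/-- **Move (2), the dilation:** `[unit octant, 7√7/64] − [octant of radius √7/4, 1] ∈ relations`
(`|det| = (√7/4)³ = 7√7/64`). [KontsevichZagier2001 §1.2 rule (2)] -/
theorem of_octSrc_sub_of_oct_mem_relations :
    KZ.of octSrc - KZ.of (cellRep octPoly 1) ∈ KZ.relations := by
  refine KZ.changeOfVariablesRel_subset_relations
    ⟨3, octSrc, cellRep octPoly 1, dil, fun _ => dil', isSemialgebraicMapOn_dil octSrc.isSemialgebraic_domain,
      fun u _ => (hasFDerivAt_dil u).hasFDerivWithinAt, injective_dil.injOn, ?_, fun u _ => ?_, rfl⟩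
  · rw [cellRep_domain]
    exact image_dil.symm
  · rw [cellRep_integrand, dil'_det, abs_of_pos (by positivity)]
    show (7 / 64 : ℝ) * √7 = ((1:ℚ):ℝ) * (√7 / 4) ^ 3
    have h73 : √7 ^ 3 = 7 * √7 := by
      rw [pow_succ, Real.sq_sqrt (by norm_num : (0:ℝ) ≤ 7)]
    push_cast
    linear_combination (-1 / 64 : ℝ) * h73

/-! #### Newton–Leibniz along `z`: `[unit octant, c] ≡ [quarter disc, c·√(1−u²−v²)]` -/

/-- `[quarter disc, c · √(1 − u² − v²)]`, `c = 7√7/64`. [KontsevichZagier2001 §1.1] -/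
def octDisc : KZ.IntegralRep 2 where
  domain := discBase
  integrand u := (7 / 64 : ℝ) * √7 * √(1 - u 0 ^ 2 - u 1 ^ 2)
  isSemialgebraic_domain := isSemialgebraic_discBase
  isSemialgebraicFunOn_integrand :=
    (IsSemialgebraicFunOn.mul_holds (isSemialgebraicFunOn_octConst isSemialgebraic_discBase)
      (IsSemialgebraicFunOn.sqrt_holds
        (isSemialgebraicFunOn_aeval isSemialgebraic_discBase discPoly))).congr fun u _ => by
      simp
  integrableOn :=
    ((continuous_const.mul (Real.continuous_sqrt.comp
      ((continuous_const.sub ((continuous_apply 0).pow 2)).sub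
        ((continuous_apply 1).pow 2)))).continuousOn.integrableOn_compact
        isCompact_Icc).mono_set fun u hu => ⟨fun j => (hu.1 j).1.le, fun j => (hu.1 j).2.le⟩

/-- The domain of `octDisc` (the open quarter disc). [folklore] -/
@[simp] theorem octDisc_domain : octDisc.domain = discBase := rfl

/-- The integrand of `octDisc`. [folklore] -/
@[simp] theorem octDisc_integrand (u : Fin 2 → ℝ) :
    octDisc.integrand u = (7 / 64 : ℝ) * √7 * √(1 - u 0 ^ 2 - u 1 ^ 2) := rfl

/-- The unit ball octant is the open band `0 < z < √(1 − u² − v²)` over the quarter disc. -/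
theorem mem_ball_iff_init (z : Fin 3 → ℝ) :
    z ∈ {w : Fin 3 → ℝ | (∀ j, 0 < w j ∧ w j < 1) ∧ 0 < aeval w ballPoly} ↔
      Fin.init z ∈ discBase ∧ 0 < z (Fin.last 2) ∧
        z (Fin.last 2) < √(1 - Fin.init z 0 ^ 2 - Fin.init z 1 ^ 2) := by
  simp only [mem_setOf_eq, aeval_ballPoly, discBase, aeval_discPoly, Fin.init]
  constructor
  · rintro ⟨hw, hg⟩
    refine ⟨⟨fun j => hw (Fin.castSucc j), ?_⟩, (hw 2).1, ?_⟩
    · have := sq_nonneg (z 2)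
      simp
      nlinarith
    · exact (Real.lt_sqrt (hw 2).1.le).2 (by simpa using hg)
  · rintro ⟨⟨hu, hd⟩, h0, h1⟩
    have h1' : z 2 < √(1 - z 0 ^ 2 - z 1 ^ 2) := by simpa using h1
    have hd' : 0 < 1 - z 0 ^ 2 - z 1 ^ 2 := by simpa using hd
    have hsq : z 2 ^ 2 < 1 - z 0 ^ 2 - z 1 ^ 2 := (Real.lt_sqrt h0.le).1 h1'
    have hle : √(1 - z 0 ^ 2 - z 1 ^ 2) ≤ 1 :=
      (Real.sqrt_le_sqrt (by nlinarith [sq_nonneg (z 0), sq_nonneg (z 1)])).trans_eq Real.sqrt_one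
    refine ⟨fun j => ?_, by linarith⟩
    fin_cases j
    · exact hu 0
    · exact hu 1
    · exact ⟨h0, by simpa using h1'.trans_le hle⟩

/-- The closed band under the hemisphere over the quarter disc lies in the closed unit cube. [folklore] -/
theorem band_discBase_sqrt_subset_Icc :
    KZlog.band discBase (fun _ => (0:ℝ)) (fun u => √(1 - u 0 ^ 2 - u 1 ^ 2)) ⊆ Icc 0 1 := by
  intro z hz
  rw [KZlog.mem_band] at hz
  obtain ⟨⟨hu, _⟩, h0, h1⟩ := hz
  simp only [Fin.init] at hu
  have hle : √(1 - Fin.init z 0 ^ 2 - Fin.init z 1 ^ 2) ≤ 1 :=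
    (Real.sqrt_le_sqrt (by simp [Fin.init]; nlinarith [sq_nonneg (z 0), sq_nonneg (z 1)])).trans_eq
      Real.sqrt_one
  refine ⟨fun j => ?_, fun j => ?_⟩
  · fin_cases j
    · exact (hu 0).1.le
    · exact (hu 1).1.le
    · exact h0
  · fin_cases j
    · exact (hu 0).2.le
    · exact (hu 1).2.le
    · exact h1.trans hle

/-- **Moves (3) + (1a):** `[unit octant, c] ≡ [quarter disc, c·√(1 − u² − v²)]` — Newton–Leibniz
along `z` with the primitive `c·z` (closed fibres `[0, √(1−u²−v²)]`), then opening the fibres.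
[KontsevichZagier2001 §1.2 rules (1), (3)] -/
theorem of_octSrc_sub_of_octDisc_mem_relations :
    KZ.of octSrc - KZ.of octDisc ∈ KZ.relations := by
  have hBs := isSemialgebraic_discBase
  have ha : IsSemialgebraicFunOn ℚ discBase (fun _ => (0:ℝ)) := by
    simpa using isSemialgebraicFunOn_ratCast hBs 0
  have hb : IsSemialgebraicFunOn ℚ discBase (fun u => √(1 - u 0 ^ 2 - u 1 ^ 2)) :=
    (IsSemialgebraicFunOn.sqrt_holds (isSemialgebraicFunOn_aeval hBs discPoly)).congr
      fun u _ => by simp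
  have hband : IsSemialgebraic ℚ
      (KZlog.band discBase (fun _ => (0:ℝ)) (fun u => √(1 - u 0 ^ 2 - u 1 ^ 2))) :=
    KZlog.isSemialgebraic_band ha hb
  obtain ⟨rb, rd, hrbd, hrbi, hrdd, hrdi, hrel⟩ := KZ.exists_band_newtonLeibniz hBs
    (fun _ => (0:ℝ)) (fun u => √(1 - u 0 ^ 2 - u 1 ^ 2)) ha hb (fun _ _ => Real.sqrt_nonneg _)
    (fun z => (7 / 64 : ℝ) * √7 * z (Fin.last 2)) (fun _ => (7 / 64 : ℝ) * √7)
    (IsSemialgebraicFunOn.mul_holds (isSemialgebraicFunOn_octConst hband)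
      ((isSemialgebraicFunOn_aeval hband (X (Fin.last 2))).congr fun z _ => by simp))
    (isSemialgebraicFunOn_octConst hband)
    (fun x _ => by
      simp only [Fin.snoc_last]
      exact (continuous_const.mul continuous_id).continuousOn)
    (fun x _ t _ => by
      simp only [Fin.snoc_last]
      simpa using (hasDerivAt_id t).const_mul ((7 / 64 : ℝ) * √7))
    (integrableOn_const (hs := ((measure_mono band_discBase_sqrt_subset_Icc).trans_lt
      (isCompact_Icc.measure_lt_top)).ne))
    (octDisc.isSemialgebraicFunOn_integrand.congr fun x _ => by
      simp only [Fin.snoc_last]; simp [octDisc])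
    (by
      have : (fun x : Fin 2 → ℝ => (7 / 64 : ℝ) * √7 *
          (Fin.snoc x ((fun u : Fin 2 → ℝ => √(1 - u 0 ^ 2 - u 1 ^ 2)) x) : Fin 3 → ℝ) (Fin.last 2) -
          (7 / 64 : ℝ) * √7 * (Fin.snoc x ((fun _ => (0:ℝ)) x) : Fin 3 → ℝ) (Fin.last 2)) =
          fun u => (7 / 64 : ℝ) * √7 * √(1 - u 0 ^ 2 - u 1 ^ 2) := by
        funext x; simp only [Fin.snoc_last]; ring
      rw [this]
      exact octDisc.integrableOn)
  obtain ⟨rb', hrb'd, hrb'i, hrel'⟩ := KZ.of_sub_of_restrict_openBand_mem_relations ha hb rb hrbd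
  have hpin1 : KZ.of rb' - KZ.of octSrc ∈ KZ.relations := by
    refine KZ.of_sub_of_mem_relations_of_eqOn ?_ fun z _ => ?_
    · rw [hrb'd]
      ext z
      simpa using mem_ball_iff_init z
    · rw [hrb'i, hrbi]
      rfl
  have hpin2 : KZ.of rd - KZ.of octDisc ∈ KZ.relations := by
    refine KZ.of_sub_of_mem_relations_of_eqOn ?_ fun u _ => ?_
    · rw [hrdd]; rfl
    · rw [hrdi]; simp only [Fin.snoc_last]; simp [octDisc]
  have : KZ.of octSrc - KZ.of octDisc =
      (KZ.of rb - KZ.of rd) - (KZ.of rb - KZ.of rb') - (KZ.of rb' - KZ.of octSrc) +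
        (KZ.of rd - KZ.of octDisc) := by abel
  rw [this]
  exact add_mem (sub_mem (sub_mem hrel hrel') hpin1) hpin2


end Summit.KontsevichZagierPeriods.RootDecompWalshStrata.PointlessOctant

end
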